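import Mathlib
import Literature.NumberTheory.LFunctions.MoebiusAutomaticCarry
import Literature.NumberTheory.LFunctions.MauduitRivatFourier
import Literature.NumberTheory.LFunctions.SumOfDigitsFourier
import Literature.NumberTheory.LFunctions.SumOfDigitsCarry
import HarnessLib

/-!
# Mauduit–Rivat 2015, Theorem 2 (Möbius randomness for digital functions with the carry and Fourier properties), base 2, quantitative form — named fact; the Gelfond sum `Σ μ(n) e(α s₂(n))` as a corollary

Topic `Literature/NumberTheory/LFunctions`. C. Mauduit, J. Rivat, *Prime numbers along Rudin–Shapiro
sequences*, J. Eur. Math. Soc. **17** (2015) 2595–2642 [MauduitRivat2015], Theorem 2 (p. 2599, (10)):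
for `f : ℕ → U` with the CARRY PROPERTY (Definition 1) lying in `F_{γ,c}` (Definition 2) for some
`c ≥ 10`, `γ` non-decreasing with `γ(λ) → ∞`, and every real `ϑ`,

  `|Σ_{n ≤ x} μ(n) f(n) e(ϑ n)| ≪ c₁(q) (log x)^{c₂(q)} x q^{−γ(2⌊(log x)/(80 log q)⌋)/20}`,

`c₂(q) = 2 + max(2, (1 + ω(q))/4)` (so `c₂(2) = 4`), the implied constant depending on `q` and on the
constant of the carry property of `f` only (the dependence on `γ` and `ϑ` is the displayed one; §8).
The tree already has the vocabulary (for Müllner's matrix version, Thm. 4.4 = `OperatorMauduitRivat`,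
which is the QUALITATIVE `o(x)` form for a FIXED `f`): `HasCarryProperty k η C f` (Definition 1 with
`η = 1`, explicit constant `C`, group-valued `f`, file `MoebiusAutomaticCarry.lean`) and
`MauduitRivat.HasFourierProperty k γ c f` (Definition 2, file `MauduitRivatFourier.lean`). Here:

* `mauduitRivat2015_thm2_base2` — the NAMED FACT: Theorem 2 for `q = 2`, scalar (`Circle`-valued `f`),
  in the QUANTITATIVE form with the uniformity made explicit by the order of quantifiers
  (`∀ C c, ∃ K, ∀ γ f x ϑ`): this uniformity in `γ` (hence in families `f_α` with `α`-dependent `γ_α`)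
  is exactly what the printed bound (explicit in `γ`) provides and what the qualitative tree interface
  `OperatorMauduitRivat 2` does not. NOT proved here (the tree's `MauduitRivat*.lean` programme is
  formalising §§5–8); never asserted.
* `SumOfDigits.norm_sum_moebius_exp_digitSum_le_of_thm2` — PROVED modulo the fact: for the binary
  sum-of-digits phase `f_α(n) = e(α s₂(n))`, whose carry property (`hasCarryProperty_exp_digitSum`,
  `C = 1`) and Fourier property (`hasFourierProperty_exp_digitSum`, every `c`,
  `γ_α(λ) = (π²/(36 log 2))‖α‖²λ − π²/(144 log 2)`) are PROVED in the tree (Mauduit–Rivat 2009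
  Lemmas 16 and 9; files `SumOfDigitsCarry.lean`, `SumOfDigitsFourier.lean`; this is the example after
  Definition 2 on p. 2598 of the paper), one gets, UNIFORMLY in `α ∉ ℤ`,
  `|Σ_{n≤x} μ(n) e(α s₂(n))| ≤ K (log x)⁴ x 2^{−(γ_α(2⌊log x/(80 log 2)⌋))/20}`.

This is the `μ`-form of the large-frequency Gelfond bound behind the symmetric-digital rung of crux
`MobiusLadder.LiouvilleOrthogonalTC0` (`GelfondLiouvilleDecay` is its `λ`-twin, not in print).
-/

noncomputable section

namespace Literature.NumberTheory.LFunctions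

open Finset Filter
open scoped FourierTransform
open Literature.NumberTheory.Sieve.Vinogradov (distInt distInt_nonneg)

/-- NAMED FACT — **Mauduit–Rivat 2015, Theorem 2, base `q = 2`, quantitative form.** For every carry
constant `C` and every `c ≥ 10` there is `K` such that for every non-decreasing `γ : ℝ → ℝ` with
`γ(λ) → ∞`, every `f : ℕ → U` (unit circle) with the carry property `HasCarryProperty 2 1 C f`
(Definition 1: `#violations(λ, κ, ρ) ≤ C·2^{λ−ρ}`) and the Fourier property
`HasFourierProperty 2 γ c f` (Definition 2: `f ∈ F_{γ,c}`), every `x ≥ 2` and every real `ϑ`: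
`|Σ_{1 ≤ n ≤ x} μ(n) f(n) e(ϑn)| ≤ K (log x)⁴ x 2^{−γ(2⌊log x/(80 log 2)⌋)/20}` (`c₂(2) = 4`; `c₁(2)` and
the implied constant are absorbed in `K`). Never asserted; taken as a hypothesis only.
[cite: MauduitRivat2015, Theorem 2 and (10), with Definitions 1–2 and §8] -/
def mauduitRivat2015_thm2_base2 : Prop :=
  ∀ (C c : ℝ), 10 ≤ c → ∃ K : ℝ, ∀ (γ : ℝ → ℝ), Monotone γ → Tendsto γ atTop atTop →
    ∀ (f : ℕ → Circle), HasCarryProperty 2 1 C f →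
      MauduitRivat.HasFourierProperty 2 γ c (fun n => ((f n : Circle) : ℂ)) →
        ∀ (x : ℕ), 2 ≤ x → ∀ (ϑ : ℝ),
          ‖∑ n ∈ Finset.Icc 1 x, (ArithmeticFunction.moebius n : ℂ) * (f n : ℂ) *
              Complex.exp (2 * Real.pi * Complex.I * (ϑ * n))‖ ≤
            K * Real.log x ^ 4 * x *
              (2 : ℝ) ^ (-(γ (2 * (⌊Real.log x / (80 * Real.log 2)⌋₊ : ℝ))) / 20)

namespace SumOfDigits

/-- The rate function of the binary sum-of-digits phase at frequency `α`:
`γ_α(λ) = (π²/(36 log 2))‖α‖²λ − π²/(144 log 2)` is non-decreasing. [cite: MauduitRivat2009, Lemme 9] -/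
theorem monotone_gammaDigitSum (α : ℝ) :
    Monotone (fun lam : ℝ => Real.pi ^ 2 / (36 * Real.log 2) * distInt α ^ 2 * lam -
      Real.pi ^ 2 / (144 * Real.log 2)) := by
  intro a b hab
  have hlog : 0 < Real.log 2 := Real.log_pos one_lt_two
  have hc : 0 ≤ Real.pi ^ 2 / (36 * Real.log 2) * distInt α ^ 2 := by
    have := distInt_nonneg α; positivity
  have := mul_le_mul_of_nonneg_left hab hc
  linarith

/-- For `α ∉ ℤ` (`‖α‖ ≠ 0`) the rate function tends to `+∞`. [cite: MauduitRivat2009, Lemme 9] -/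
theorem tendsto_gammaDigitSum {α : ℝ} (hα : distInt α ≠ 0) :
    Tendsto (fun lam : ℝ => Real.pi ^ 2 / (36 * Real.log 2) * distInt α ^ 2 * lam -
      Real.pi ^ 2 / (144 * Real.log 2)) atTop atTop := by
  have hlog : 0 < Real.log 2 := Real.log_pos one_lt_two
  have hd : 0 < distInt α := lt_of_le_of_ne (distInt_nonneg α) (Ne.symm hα)
  have hc : 0 < Real.pi ^ 2 / (36 * Real.log 2) * distInt α ^ 2 := by positivity
  exact tendsto_atTop_add_const_right _ _ (Tendsto.const_mul_atTop hc tendsto_id)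

/-- **The Möbius–Gelfond bound from Theorem 2** (PROVED modulo `mauduitRivat2015_thm2_base2`): there is
`K` such that for every real `α` with `‖α‖ ≠ 0` and every `x ≥ 2`,
`|Σ_{1≤n≤x} μ(n) e(α s₂(n))| ≤ K (log x)⁴ x 2^{−γ_α(2⌊log x/(80 log 2)⌋)/20}`,
`γ_α(λ) = (π²/(36 log 2))‖α‖²λ − π²/(144 log 2)` — Theorem 2 for `f_α = e(α s₂)` with the carry
property `hasCarryProperty_exp_digitSum` (`C = 1`) and the Fourier property
`hasFourierProperty_exp_digitSum` (`c = 10`). [cite: MauduitRivat2015, Theorem 2 and p. 2598] -/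
theorem norm_sum_moebius_exp_digitSum_le_of_thm2 (h : mauduitRivat2015_thm2_base2) :
    ∃ K : ℝ, ∀ (α : ℝ), distInt α ≠ 0 → ∀ (x : ℕ), 2 ≤ x →
      ‖∑ n ∈ Finset.Icc 1 x, (ArithmeticFunction.moebius n : ℂ) *
          Complex.exp (((2 * Real.pi * (α * ((Nat.digits 2 n).sum : ℕ))) : ℝ) * Complex.I)‖ ≤
        K * Real.log x ^ 4 * x *
          (2 : ℝ) ^ (-(Real.pi ^ 2 / (36 * Real.log 2) * distInt α ^ 2 *
              (2 * (⌊Real.log x / (80 * Real.log 2)⌋₊ : ℝ)) - Real.pi ^ 2 / (144 * Real.log 2)) / 20) := by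
  obtain ⟨K, hK⟩ := h 1 10 le_rfl
  refine ⟨K, fun α hα x hx => ?_⟩
  set f : ℕ → Circle := fun n => 𝐞 (α * ((Nat.digits 2 n).sum : ℕ)) with hf
  have hF : MauduitRivat.HasFourierProperty 2
      (fun lam : ℝ => Real.pi ^ 2 / (36 * Real.log 2) * distInt α ^ 2 * lam -
        Real.pi ^ 2 / (144 * Real.log 2)) 10 (fun n => ((f n : Circle) : ℂ)) :=
    hasFourierProperty_exp_digitSum α 10
  have hmain := hK _ (monotone_gammaDigitSum α) (tendsto_gammaDigitSum hα) f
    (hasCarryProperty_exp_digitSum α) hF x hx 0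
  simp only [Complex.ofReal_zero, zero_mul, mul_zero, Complex.exp_zero, mul_one] at hmain
  exact hmain

end SumOfDigits

end Literature.NumberTheory.LFunctions
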